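import Summits.QuantumFields.YangMills.Theorems.SwapVirialDeficitZeroModeSigmaFourSmallBallExplicit
import HarnessLib

/-!
# Exact zero-mode rung Z5 — toward the POWER RATE of the σ-twisted four-leader small ball, measure side I: shells and flips
# (free-hands support of ⟨stmt-QuantumFields-24197⟩; division of labour with w3 g63 (deterministic Taylor package T1–T3) agreed on STATUS 10:58Z/11:03Z)

The rate `|Haar⁴(E_σ(t))/t⁷ − sigmaV| ≤ K·t^θ` is `r⁻⁷·coneConst³·∫ |vol³(rescaledSigmaR r s A) − vol³(limSigma r A)| dcone(a)` (✓`haar_sigmaBall_div_eq_R`,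
✓`volume_limSigma_scale`).  This file is the HUB-FREE part of the measure side:
* §A ★ `limSigma_mono` and the EXACT SHELL `vol³(limSigma (r+δ) A \ limSigma (r−δ) A) = ((r+δ)⁷ − (r−δ)⁷)·vol³(limSigma 1 A)` (7-homogeneity, w3 g63's
  ✓`volume_limSigma_scale`; no boundary geometry), with the elementary bound `(r+δ)⁷ − (r−δ)⁷ ≤ 14δ(r+δ)⁶`;
* §B ★★ `mem_shell_of_flip` — if at a point the six relation maps are `sδ`-close to their slopes, `‖M_i(s) − s•L_i‖ ≤ s·δ`, and the three ball conditions
  agree, then a FLIP between `rescaledSigmaR r s A` and `limSigma r A` forces `w ∈ limSigma (r+δ) A \ limSigma (r−δ) A`.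
Part II (after w3 g63's (T2) `‖Mrel − s•Lrel‖ ≤ K'·s²·R`): the bad regions `{R > R₀}`, `{s·m > 1/2}`, ball-flip layers, `z₀ ≤ 0`, and the hub integral.
HONEST LABEL: finite-dimensional measure theory (plan-level zero-mode rung of a DRAFT line «sharp-sigma»); NOT the fixed-`L` sharp law, NOT ⟨24197⟩;
the Yang–Mills mass gap is NOT proved; no summit is proved by a line.  Width seat ym-line-sfw-p2-w2 g56 (cell ym-idea-1, free hands; own crux ⟨22884⟩
blocked-on ⟨19935⟩), `--supports stmt-QuantumFields-24197`.  THEOREMS ONLY, standard axioms, 0 `sorry`.  References: [cite: Luscher1983, §2]; [cite: Vanbaal2001]; [folklore].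
-/

set_option autoImplicit false

noncomputable section

open MeasureTheory Quaternion Set Filter Topology
open scoped Quaternion ENNReal BigOperators
open Literature.MathematicalPhysics.QuantumLattice
open Literature.Analysis.Calculus (radialUnit radialUnit_def norm_radialUnit tangentialProj)
open Summit.QuantumFields.YangMills.Theorems.SwapTwistDeficit.ToronLog
open Summit.QuantumFields.YangMills.Theorems.SwapVirialDeficit.ZeroModeGroup

attribute [local instance] Literature.Analysis.FluidPDE.Tao2016.quatMeasurableSpace
  Literature.Analysis.FluidPDE.Tao2016.quatBorelSpace
  Literature.MathematicalPhysics.QuantumLattice.secondCountableTopology_su2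

namespace Summit.QuantumFields.YangMills.Theorems.SwapVirialDeficit.ZeroModeSigma

/-! ## §A The exact shell of the limit event -/

/-- ★ `limSigma` is monotone in the tolerance `r`. [folklore] -/
theorem limSigma_mono {r r' : ℝ} (h : r ≤ r') (A : ℍ) : limSigma r A ⊆ limSigma r' A := by
  intro w hw
  rw [mem_limSigma_iff] at hw ⊢
  exact ⟨fun i => (hw.1 i).trans h, hw.2⟩

/-- The per-hub limit event `limSigma r (A(a))`, `A(a) = radialUnit (axisPoint a)`, is measurable (section of ✓`measurableSet_limSigma_hub`). [folklore] -/
theorem measurableSet_limSigma_axis (r : ℝ) (a : ℍ) : MeasurableSet (limSigma r (radialUnit (axisPoint a))) := by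
  have h := (measurableSet_limSigma_hub r).preimage (measurable_const.prodMk measurable_id : Measurable fun w : (ℍ × ℍ) × ℍ => (a, w))
  exact h

/-- ★ **THE EXACT SHELL**: `vol³(limSigma (r+δ) A \ limSigma (r−δ) A) = ((r+δ)⁷ − (r−δ)⁷)·vol³(limSigma 1 A)` for `0 < r − δ`, `0 ≤ δ`,
`A = A(a)` an axis hub unit, when `vol³(limSigma 1 A) < ∞`. [folklore] -/
theorem volume_shell_eq {r δ : ℝ} (hδ : 0 ≤ δ) (hr : 0 < r - δ) (a : ℍ) (hfin : vol3 (limSigma 1 (radialUnit (axisPoint a))) ≠ ∞) :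
    vol3 (limSigma (r + δ) (radialUnit (axisPoint a)) \ limSigma (r - δ) (radialUnit (axisPoint a))) =
      ENNReal.ofReal ((r + δ) ^ 7 - (r - δ) ^ 7) * vol3 (limSigma 1 (radialUnit (axisPoint a))) := by
  set A := radialUnit (axisPoint a)
  have hr' : 0 < r + δ := by linarith
  have hsub : limSigma (r - δ) A ⊆ limSigma (r + δ) A := limSigma_mono (by linarith) A
  have hfin' : vol3 (limSigma (r - δ) A) ≠ ∞ := by
    rw [volume_limSigma_scale hr]; exact ENNReal.mul_ne_top ENNReal.ofReal_ne_top hfin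
  rw [measure_sdiff hsub (measurableSet_limSigma_axis (r - δ) a).nullMeasurableSet hfin', volume_limSigma_scale hr', volume_limSigma_scale hr,
    ← ENNReal.sub_mul (fun _ _ => hfin), ← ENNReal.ofReal_sub _ (by positivity)]

/-- `(r+δ)⁷ − (r−δ)⁷ ≤ 14·δ·(r+δ)⁶` for `0 ≤ δ ≤ r`. [folklore] -/
theorem pow_seven_sub_le {r δ : ℝ} (hδ : 0 ≤ δ) (hr : δ ≤ r) : (r + δ) ^ 7 - (r - δ) ^ 7 ≤ 14 * δ * (r + δ) ^ 6 := by
  set a := r + δ with ha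
  set b := r - δ with hb
  have h0 : 0 ≤ b := by rw [hb]; linarith
  have h1 : b ≤ a := by rw [ha, hb]; linarith
  have ha0 : 0 ≤ a := h0.trans h1
  have e : a ^ 7 - b ^ 7 = (a - b) * (a ^ 6 + a ^ 5 * b + a ^ 4 * b ^ 2 + a ^ 3 * b ^ 3 + a ^ 2 * b ^ 4 + a * b ^ 5 + b ^ 6) := by ring
  have hab : a - b = 2 * δ := by rw [ha, hb]; ring
  have hk : ∀ k : ℕ, k ≤ 6 → a ^ k * b ^ (6 - k) ≤ a ^ 6 := by
    intro k hk
    calc a ^ k * b ^ (6 - k) ≤ a ^ k * a ^ (6 - k) := mul_le_mul_of_nonneg_left (pow_le_pow_left₀ h0 h1 _) (pow_nonneg ha0 _)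
      _ = a ^ 6 := by rw [← pow_add, Nat.add_sub_cancel' hk]
  have h6 := hk 6 le_rfl; have h5 := hk 5 (by norm_num); have h4 := hk 4 (by norm_num); have h3 := hk 3 (by norm_num)
  have h2 := hk 2 (by norm_num); have h1' := hk 1 (by norm_num); have h0' := hk 0 (by norm_num)
  simp only [Nat.sub_self, pow_zero, mul_one, pow_one, one_mul, show 6 - 5 = 1 from rfl, show 6 - 4 = 2 from rfl, show 6 - 3 = 3 from rfl,
    show 6 - 2 = 4 from rfl, show 6 - 1 = 5 from rfl, show 6 - 0 = 6 from rfl] at h6 h5 h4 h3 h2 h1' h0'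
  rw [e, hab]
  nlinarith [h6, h5, h4, h3, h2, h1', h0']

/-- ★ **SHELL BOUND**: `vol³(limSigma (r+δ) A \ limSigma (r−δ) A) ≤ 14δ(r+δ)⁶·vol³(limSigma 1 A)` (`0 ≤ δ < r`, axis hub unit `A = A(a)`). [folklore] -/
theorem volume_shell_le {r δ : ℝ} (hδ : 0 ≤ δ) (hr : 0 < r - δ) (a : ℍ) :
    vol3 (limSigma (r + δ) (radialUnit (axisPoint a)) \ limSigma (r - δ) (radialUnit (axisPoint a))) ≤
      ENNReal.ofReal (14 * δ * (r + δ) ^ 6) * vol3 (limSigma 1 (radialUnit (axisPoint a))) := by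
  have hrδ : 0 < r + δ := by linarith
  by_cases hfin : vol3 (limSigma 1 (radialUnit (axisPoint a))) = ∞
  · by_cases hδ0 : δ = 0
    · subst hδ0
      rw [add_zero, sub_zero, sdiff_self]; simp
    · have hpos : 0 < 14 * δ * (r + δ) ^ 6 := by
        have : 0 < δ := lt_of_le_of_ne hδ (Ne.symm hδ0); positivity
      rw [hfin, ENNReal.mul_top (ENNReal.ofReal_pos.2 hpos).ne']; exact le_top
  rw [volume_shell_eq hδ hr a hfin]
  exact mul_le_mul' (ENNReal.ofReal_le_ofReal (pow_seven_sub_le hδ (by linarith))) le_rfl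

/-! ## §B A flip under slope control lies in the shell -/

/-- If `‖M − s•L‖ ≤ s·δ` with `s > 0`, then `‖M‖ ≤ r·s ⇒ ‖L‖ ≤ r + δ` and `‖L‖ ≤ r − δ ⇒ ‖M‖ ≤ r·s`. [folklore] -/
theorem norm_flip_control {M L : ℍ} {s δ r : ℝ} (hs : 0 < s) (h : ‖M - s • L‖ ≤ s * δ) :
    (‖M‖ ≤ r * s → ‖L‖ ≤ r + δ) ∧ (‖L‖ ≤ r - δ → ‖M‖ ≤ r * s) := by
  have hsL : ‖s • L‖ = s * ‖L‖ := by rw [norm_smul, Real.norm_eq_abs, abs_of_pos hs]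
  constructor
  · intro hM
    have h1 : ‖s • L‖ ≤ ‖M‖ + ‖M - s • L‖ := by
      calc ‖s • L‖ = ‖M - (M - s • L)‖ := by rw [sub_sub_cancel]
        _ ≤ ‖M‖ + ‖M - s • L‖ := norm_sub_le _ _
    rw [hsL] at h1
    have : s * ‖L‖ ≤ s * (r + δ) := by nlinarith
    exact le_of_mul_le_mul_left this hs
  · intro hL
    calc ‖M‖ = ‖(M - s • L) + s • L‖ := by rw [sub_add_cancel]
      _ ≤ ‖M - s • L‖ + ‖s • L‖ := norm_add_le _ _
      _ ≤ s * δ + s * (r - δ) := by rw [hsL]; exact add_le_add h (mul_le_mul_of_nonneg_left hL hs.le)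
      _ = r * s := by ring

/-- ★★ **A FLIP LIES IN THE SHELL**: at a point `w = ((x,y),z)` with `z₀ > 0` where the six relation maps are slope-controlled,
`‖Mrel A x y z i s − s•Lrel A x y z i‖ ≤ s·δ`, and the three ball conditions at scale `s` agree with their limits, a disagreement between
`w ∈ rescaledSigmaR r s A` and `w ∈ limSigma r A` forces `w ∈ limSigma (r+δ) A \ limSigma (r−δ) A`. [folklore] -/
theorem mem_shell_of_flip {r s δ : ℝ} {A : ℍ} (hs : 0 < s) {w : (ℍ × ℍ) × ℍ} (hz : 0 < w.2.re)
    (hctrl : ∀ i : Fin 6, ‖Mrel A w.1.1 w.1.2 w.2 i s - s • Lrel A w.1.1 w.1.2 w.2 i‖ ≤ s * δ)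
    (hbx : ‖dilate s w.1.1‖ < 1 ↔ ‖axPart w.1.1‖ < 1) (hby : ‖dilate s w.1.2‖ < 1 ↔ ‖axPart w.1.2‖ < 1)
    (hbz : ‖dilateIm s w.2‖ < 1 ↔ ‖(w.2.re : ℍ)‖ < 1)
    (hflip : ¬ (w ∈ rescaledSigmaR r s A ↔ w ∈ limSigma r A)) :
    w ∈ limSigma (r + δ) A \ limSigma (r - δ) A := by
  have hc := fun i => norm_flip_control (r := r) hs (hctrl i)
  rw [mem_rescaledSigmaR_iff, mem_limSigma_iff, hbx, hby, hbz] at hflip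
  rw [Set.mem_sdiff, mem_limSigma_iff, mem_limSigma_iff]
  by_cases hR : (∀ i : Fin 6, ‖Mrel A w.1.1 w.1.2 w.2 i s‖ ≤ r * s) ∧ (‖axPart w.1.1‖ < 1 ∧ ‖axPart w.1.2‖ < 1) ∧ ‖(w.2.re : ℍ)‖ < 1
  · -- in the rescaled event, hence not in the limit event: some `‖L_i‖ > r`
    have hnotL : ¬ ((∀ i : Fin 6, ‖Lrel A w.1.1 w.1.2 w.2 i‖ ≤ r) ∧ (‖axPart w.1.1‖ < 1 ∧ ‖axPart w.1.2‖ < 1) ∧ ‖(w.2.re : ℍ)‖ < 1 ∧ 0 < w.2.re) :=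
      fun hL => hflip ⟨fun _ => hL, fun _ => hR⟩
    refine ⟨⟨fun i => (hc i).1 (hR.1 i), hR.2.1, hR.2.2, hz⟩, fun hL' => hnotL ⟨fun i => ?_, hR.2.1, hR.2.2, hz⟩⟩
    -- `‖L_i‖ ≤ r − δ ≤ r`… no: we need `‖L_i‖ ≤ r`; from `hL'` we only get `≤ r − δ`, which suffices when `δ ≥ 0`; in general use `hc`:
    have h1 := hL'.1 i
    by_cases hδ : 0 ≤ δ
    · linarith
    · -- `δ < 0`: then `‖M_i‖ ≤ r s` gives `‖L_i‖ ≤ r + δ < r`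
      have := (hc i).1 (hR.1 i); linarith
  · -- not in the rescaled event, hence in the limit event
    have hL : (∀ i : Fin 6, ‖Lrel A w.1.1 w.1.2 w.2 i‖ ≤ r) ∧ (‖axPart w.1.1‖ < 1 ∧ ‖axPart w.1.2‖ < 1) ∧ ‖(w.2.re : ℍ)‖ < 1 ∧ 0 < w.2.re := by
      by_contra hL; exact hflip ⟨fun h => absurd h hR, fun h => absurd h hL⟩
    refine ⟨⟨fun i => ?_, hL.2.1, hL.2.2.1, hz⟩, fun hL' => hR ⟨fun i => (hc i).2 (hL'.1 i), hL.2.1, hL.2.2.1⟩⟩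
    have h1 := hL.1 i
    by_cases hδ : 0 ≤ δ
    · linarith
    · -- `δ < 0`: `‖L_i‖ ≤ r ≤ r − δ` would put `w` in the rescaled event, contradiction — so this case gives anything via `hR`
      exfalso; exact hR ⟨fun j => (hc j).2 (by linarith [hL.1 j]), hL.2.1, hL.2.2.1⟩

end Summit.QuantumFields.YangMills.Theorems.SwapVirialDeficit.ZeroModeSigma

end
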